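import Mathlib
import HarnessLib

/-!
# `WakeRatchet.TailRatchet` (stmt-NavierStokesRegularity-21808), door D4′ — the WAKE LOCK of the dyadic cascade:
# the sign boundary of `Ẋ` moves only upward

Def-free helper lemmas (`--supports stmt-NavierStokesRegularity-21808`) for the one estimate left on door D4′ of the
item's census, the post-firing bound (D) `WakeRatchetDyadicPostFiring.DyadicCauchyPostFiringBound` for the one-shell
non-negative dyadic cascade `Ẋₙ = Λⁿ⁻¹Xₙ₋₁² − ΛⁿXₙXₙ₊₁` (the scalar member of Tao 2016 §1.2 / §4; MODEL lattice ODEs —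
nothing in this file is a statement about the Navier–Stokes equations, and no stub of skeleton d00b85951d7c is closed).

THE MECHANISM.  Write `Zₙ := Ẋₙ = Λⁿ⁻¹Xₙ₋₁² − ΛⁿXₙXₙ₊₁` (the DRIVE of shell `n`).  Along a solution the drives solve the
LINEAR chain `Żₙ = 2Λⁿ⁻¹Xₙ₋₁Zₙ₋₁ − Λⁿ(ZₙXₙ₊₁ + XₙZₙ₊₁)` (`hasDerivAt_drive`), so at a critical moment `Zₙ = 0` of shell `n`
`Żₙ = 2Λⁿ⁻¹Xₙ₋₁Zₙ₋₁ − ΛⁿXₙZₙ₊₁` (`= ΛⁿXₙXₙ₊₁(2gₙ₋₁ − gₙ₊₁)` with the growth rates `gₖ = Zₖ/Xₖ`, `drive_deriv_eq_rates`).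
Consequently (`drive_deriv_neg_of_lock`, `shell_wake_lock`): a shell sitting between a DECAYING shell below (`Zₙ₋₁ ≤ 0`) and a
RISING shell above (`Zₙ₊₁ > 0`) cannot turn up — once `Zₙ ≤ 0` it stays `≤ 0` on the whole window (and dually
`shell_edge_lock`: between a rising shell below and a decaying shell above it cannot turn down).  Hence the sign pattern
`(−,…,−,+,…,+)` of `(Zₖ)ₖ` can only lose its `+`'s from below: the sign boundary of `Ẋ` moves only UPWARD, and a second
extremum of a fired shell can only be born deep in the wake, at a moment when the shell above decays more than twice as
fast as the shell below (`2gₙ₋₁ < gₙ₊₁ < 0`).  This is the boundary part of the invariant-region route to (D) recorded in the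
item's census CENSUS-21808-leafhand4-g19.md (numerically every `Ẋₙ`, `n ≥ 1`, has exactly one zero for `Λ ∈ [1.15, 1.85]`).

The analytic core is the abstract `le_zero_of_deriv_neg_at_zeros` (a differentiable function that starts `≤ 0` and has
negative derivative at each of its zeros stays `≤ 0`; real induction via `IsClosed.Icc_subset_of_forall_mem_nhdsWithin`).

HONEST FRAMING: elementary real analysis about a MODEL lattice ODE; (D) itself is NOT proved here; rung 0.
-/

noncomputable section

set_option linter.dupNamespace false

namespace Summit.NavierStokesRegularity.NavierStokesRegularity.Theorems

namespace WakeRatchetDyadicWakeLock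

open Set Filter Topology

/-! ## Real-analysis core -/

/-- A function with a NEGATIVE derivative at a zero is negative immediately to the right of it.
[folklore] -/
theorem eventually_neg_right_of_hasDerivAt {f : ℝ → ℝ} {f' t₀ : ℝ} (hf : HasDerivAt f f' t₀)
    (h0 : f t₀ = 0) (hneg : f' < 0) : ∀ᶠ t in 𝓝[>] t₀, f t < 0 := by
  have hs : Tendsto (slope f t₀) (𝓝[≠] t₀) (𝓝 f') := hasDerivAt_iff_tendsto_slope.1 hf
  have hs' : Tendsto (slope f t₀) (𝓝[>] t₀) (𝓝 f') :=
    hs.mono_left (nhdsWithin_mono _ fun t ht => ne_of_gt ht)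
  have hev : ∀ᶠ t in 𝓝[>] t₀, slope f t₀ t < 0 := hs'.eventually (gt_mem_nhds hneg)
  have hgt : ∀ᶠ t in 𝓝[>] t₀, t₀ < t := eventually_nhdsWithin_of_forall fun t ht => ht
  filter_upwards [hev, hgt] with t h1 h2
  rw [slope_def_field, h0, sub_zero] at h1
  have hpos : 0 < t - t₀ := sub_pos.2 h2
  by_contra hcon
  have hcon' : 0 ≤ f t := not_lt.1 hcon
  have : 0 ≤ f t / (t - t₀) := div_nonneg hcon' hpos.le
  linarith

/-- **Real induction with a one-sided barrier.**  A function differentiable on `[a,b]`, `≤ 0` at `a`, whose derivative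
is NEGATIVE at every zero in `[a,b)`, stays `≤ 0` on `[a,b]`.
[folklore] -/
theorem le_zero_of_deriv_neg_at_zeros {Z Z' : ℝ → ℝ} {a b : ℝ}
    (hZ : ∀ t ∈ Icc a b, HasDerivAt Z (Z' t) t)
    (hcrit : ∀ t ∈ Ico a b, Z t = 0 → Z' t < 0) (ha : Z a ≤ 0) :
    ∀ t ∈ Icc a b, Z t ≤ 0 := by
  have hcont : ContinuousOn Z (Icc a b) := fun t ht => (hZ t ht).continuousAt.continuousWithinAt
  have hclosed : IsClosed ({t | Z t ≤ 0} ∩ Icc a b) := by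
    rw [Set.inter_comm]
    exact hcont.preimage_isClosed_of_isClosed isClosed_Icc isClosed_Iic
  have key : Icc a b ⊆ {t | Z t ≤ 0} := by
    refine hclosed.Icc_subset_of_forall_mem_nhdsWithin ha ?_
    rintro x ⟨hx0, hxa, hxb⟩
    have hx0' : Z x ≤ 0 := hx0
    rcases hx0'.lt_or_eq with hlt | heq
    · have hc : ContinuousAt Z x := (hZ x ⟨hxa, hxb.le⟩).continuousAt
      have hev : ∀ᶠ t in 𝓝 x, Z t < 0 := hc.eventually_lt continuousAt_const hlt
      exact mem_nhdsWithin_of_mem_nhds (hev.mono fun t ht => le_of_lt ht)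
    · have hd : Z' x < 0 := hcrit x ⟨hxa, hxb⟩ heq
      have hev := eventually_neg_right_of_hasDerivAt (hZ x ⟨hxa, hxb.le⟩) heq hd
      exact hev.mono fun t ht => le_of_lt ht
  exact fun t ht => key ht

/-- Dual barrier: differentiable on `[a,b]`, `≥ 0` at `a`, derivative POSITIVE at every zero in `[a,b)` ⟹ `≥ 0` on `[a,b]`.
[folklore] -/
theorem nonneg_of_deriv_pos_at_zeros {Z Z' : ℝ → ℝ} {a b : ℝ}
    (hZ : ∀ t ∈ Icc a b, HasDerivAt Z (Z' t) t)
    (hcrit : ∀ t ∈ Ico a b, Z t = 0 → 0 < Z' t) (ha : 0 ≤ Z a) :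
    ∀ t ∈ Icc a b, 0 ≤ Z t := by
  have h := le_zero_of_deriv_neg_at_zeros (Z := fun t => -Z t) (Z' := fun t => -Z' t)
    (fun t ht => (hZ t ht).neg) (fun t ht h0 => neg_neg_of_pos (hcrit t ht (neg_eq_zero.1 h0)))
    (neg_nonpos.2 ha)
  intro t ht
  have := h t ht
  simpa using this

/-! ## The drive chain of the dyadic cascade -/

/-- **The drives solve a linear chain.**  If the three shells `u = Xₙ₋₁`, `v = Xₙ`, `w = Xₙ₊₁` are differentiable at `t`,
the drive `Zₙ = Λⁿ⁻¹u² − Λⁿvw` of shell `n` has derivative `2Λⁿ⁻¹u u′ − Λⁿ(v′w + v w′)` there.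
[cite: Tao2016AveragedNS, §1.2 (the dyadic model `∂ₜXₙ = λⁿ⁻¹Xₙ₋₁² − λⁿXₙXₙ₊₁`); elementary calculus] -/
theorem hasDerivAt_drive {Λ : ℝ} {n : ℤ} {u v w : ℝ → ℝ} {u' v' w' t : ℝ}
    (hu : HasDerivAt u u' t) (hv : HasDerivAt v v' t) (hw : HasDerivAt w w' t) :
    HasDerivAt (fun s => Λ ^ (n - 1) * u s ^ 2 - Λ ^ n * v s * w s)
      (2 * Λ ^ (n - 1) * u t * u' - Λ ^ n * (v' * w t + v t * w')) t := by
  have h1 : HasDerivAt (fun s => u s * u s) (u' * u t + u t * u') t := hu.mul hu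
  have h2 : HasDerivAt (fun s => v s * w s) (v' * w t + v t * w') t := hv.mul hw
  have h3 := (h1.const_mul (Λ ^ (n - 1))).sub (h2.const_mul (Λ ^ n))
  have hfun : (fun s => Λ ^ (n - 1) * u s ^ 2 - Λ ^ n * v s * w s)
      = fun s => Λ ^ (n - 1) * (u s * u s) - Λ ^ n * (v s * w s) := by
    funext s; ring
  rw [hfun]
  exact h3.congr_deriv (by ring)

/-- **The drive derivative at a critical moment, in growth rates.**  At a zero of the drive of shell `n`
(`Λⁿ⁻¹u² = Λⁿvw`, `u, w ≠ 0`), `2Λⁿ⁻¹u u′ − Λⁿ v w′ = Λⁿ v w (2 u′/u − w′/w)`: the shell turns up iff the shell above decays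
more than twice as fast (in logarithmic rate) as the shell below.
[cite: Tao2016AveragedNS, §1.2 (dyadic model); elementary algebra] -/
theorem drive_deriv_eq_rates {Λ : ℝ} {n : ℤ} {u v w u' w' : ℝ} (hu : u ≠ 0) (hw : w ≠ 0)
    (hcrit : Λ ^ (n - 1) * u ^ 2 = Λ ^ n * v * w) :
    2 * Λ ^ (n - 1) * u * u' - Λ ^ n * (0 * w + v * w')
      = Λ ^ n * v * w * (2 * (u' / u) - w' / w) := by
  have h1 : Λ ^ n * v * w * (2 * (u' / u)) = 2 * Λ ^ (n - 1) * u * u' := by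
    rw [← hcrit]; field_simp
  have h2 : Λ ^ n * v * w * (w' / w) = Λ ^ n * v * w' := by
    field_simp
  rw [mul_sub, h1, h2]
  ring

/-- **No turn-up between a decaying shell below and a rising shell above.**  At a critical moment of shell `n`
(`v′ = 0`) with `u = Xₙ₋₁ ≥ 0` decaying (`u′ ≤ 0`), `v = Xₙ > 0` and `w = Xₙ₊₁` rising (`w′ > 0`), the drive of shell `n`
has NEGATIVE derivative (`Λ > 0`).
[cite: Tao2016AveragedNS, §1.2 (dyadic model); elementary] -/
theorem drive_deriv_neg_of_lock {Λ : ℝ} (hΛ : 0 < Λ) {n : ℤ} {u v w u' w' : ℝ}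
    (hu : 0 ≤ u) (hu' : u' ≤ 0) (hv : 0 < v) (hw' : 0 < w') :
    2 * Λ ^ (n - 1) * u * u' - Λ ^ n * (0 * w + v * w') < 0 := by
  have hp1 : 0 < Λ ^ (n - 1) := zpow_pos hΛ _
  have hp2 : 0 < Λ ^ n := zpow_pos hΛ _
  have ha : 2 * Λ ^ (n - 1) * u * u' ≤ 0 :=
    mul_nonpos_of_nonneg_of_nonpos (by positivity) hu'
  have hb : 0 < Λ ^ n * (0 * w + v * w') := by
    rw [zero_mul, zero_add]
    exact mul_pos hp2 (mul_pos hv hw')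
  linarith

/-- Dual: at a critical moment of shell `n` with the shell below `u > 0` RISING (`u′ > 0`), `v = Xₙ ≥ 0` and the shell above
DECAYING (`w′ ≤ 0`), the drive of shell `n` has POSITIVE derivative.
[cite: Tao2016AveragedNS, §1.2 (dyadic model); elementary] -/
theorem drive_deriv_pos_of_edge {Λ : ℝ} (hΛ : 0 < Λ) {n : ℤ} {u v w u' w' : ℝ}
    (hu : 0 < u) (hu' : 0 < u') (hv : 0 ≤ v) (hw' : w' ≤ 0) :
    0 < 2 * Λ ^ (n - 1) * u * u' - Λ ^ n * (0 * w + v * w') := by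
  have hp1 : 0 < Λ ^ (n - 1) := zpow_pos hΛ _
  have hp2 : 0 < Λ ^ n := zpow_pos hΛ _
  have ha : 0 < 2 * Λ ^ (n - 1) * u * u' := by positivity
  have hb : Λ ^ n * (0 * w + v * w') ≤ 0 := by
    rw [zero_mul, zero_add]
    exact mul_nonpos_of_nonneg_of_nonpos hp2.le (mul_nonpos_of_nonneg_of_nonpos hv hw')
  linarith

/-! ## The wake lock along a solution of the cascade -/

variable {Λ lo hi : ℝ} {X : ℤ → ℝ → ℝ}

/-- Along a solution of `Ẋₙ = Λⁿ⁻¹Xₙ₋₁² − ΛⁿXₙXₙ₊₁` on `(lo, hi)`, `deriv Xₖ` is the drive.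
[cite: Tao2016AveragedNS, §1.2 (dyadic model); bookkeeping] -/
theorem deriv_eq_drive
    (hlaw : ∀ (n : ℤ) (t : ℝ), t ∈ Ioo lo hi →
      HasDerivAt (X n) (Λ ^ (n - 1) * X (n - 1) t ^ 2 - Λ ^ n * X n t * X (n + 1) t) t)
    (n : ℤ) {t : ℝ} (ht : t ∈ Ioo lo hi) :
    deriv (X n) t = Λ ^ (n - 1) * X (n - 1) t ^ 2 - Λ ^ n * X n t * X (n + 1) t :=
  (hlaw n t ht).deriv

/-- Along a solution, the drive of shell `n` is differentiable with derivative
`2Λⁿ⁻¹Xₙ₋₁·Ẋₙ₋₁ − Λⁿ(Ẋₙ Xₙ₊₁ + Xₙ Ẋₙ₊₁)` (the linear drive chain).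
[cite: Tao2016AveragedNS, §1.2 (dyadic model); elementary calculus] -/
theorem hasDerivAt_deriv
    (hlaw : ∀ (n : ℤ) (t : ℝ), t ∈ Ioo lo hi →
      HasDerivAt (X n) (Λ ^ (n - 1) * X (n - 1) t ^ 2 - Λ ^ n * X n t * X (n + 1) t) t)
    (n : ℤ) {t : ℝ} (ht : t ∈ Ioo lo hi) :
    HasDerivAt (fun s => Λ ^ (n - 1) * X (n - 1) s ^ 2 - Λ ^ n * X n s * X (n + 1) s)
      (2 * Λ ^ (n - 1) * X (n - 1) t * deriv (X (n - 1)) t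
        - Λ ^ n * (deriv (X n) t * X (n + 1) t + X n t * deriv (X (n + 1)) t)) t :=
  hasDerivAt_drive (hlaw (n - 1) t ht).differentiableAt.hasDerivAt
    (hlaw n t ht).differentiableAt.hasDerivAt (hlaw (n + 1) t ht).differentiableAt.hasDerivAt

/-- **WAKE LOCK.**  Let `X` solve the dyadic cascade `Ẋₙ = Λⁿ⁻¹Xₙ₋₁² − ΛⁿXₙXₙ₊₁` (`Λ > 0`) on `(lo, hi)` and let
`[a,b] ⊂ (lo,hi)` be a window on which shell `n−1` is non-negative and DECAYING (`Ẋₙ₋₁ ≤ 0`), shell `n` is positive, and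
shell `n+1` is RISING (`Ẋₙ₊₁ > 0`).  If shell `n` is not rising at time `a` (`Ẋₙ(a) ≤ 0`), it never rises on `[a,b]`.
(So a fired shell locked between its decaying lower neighbour and its rising upper neighbour cannot regrow; the sign
boundary of `(Ẋₖ)ₖ` moves only upward.)
[cite: Tao2016AveragedNS, §1.2 (dyadic model: energy moves from mode `n` to mode `n+1`); cell vocabulary (door D4′ of stmt-21808)] -/
theorem shell_wake_lock (hΛ : 0 < Λ)
    (hlaw : ∀ (n : ℤ) (t : ℝ), t ∈ Ioo lo hi →
      HasDerivAt (X n) (Λ ^ (n - 1) * X (n - 1) t ^ 2 - Λ ^ n * X n t * X (n + 1) t) t)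
    (n : ℤ) {a b : ℝ} (hab : a ≤ b) (hlo : lo < a) (hhi : b < hi)
    (hbelow₀ : ∀ t ∈ Icc a b, 0 ≤ X (n - 1) t) (hbelow : ∀ t ∈ Icc a b, deriv (X (n - 1)) t ≤ 0)
    (hmid : ∀ t ∈ Icc a b, 0 < X n t) (habove : ∀ t ∈ Icc a b, 0 < deriv (X (n + 1)) t)
    (hstart : deriv (X n) a ≤ 0) :
    ∀ t ∈ Icc a b, deriv (X n) t ≤ 0 := by
  have hsub : ∀ t ∈ Icc a b, t ∈ Ioo lo hi := fun t ht => ⟨hlo.trans_le ht.1, ht.2.trans_lt hhi⟩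
  -- work with the drive `Z` of shell `n`, which agrees with `deriv (X n)` on the window
  set Z : ℝ → ℝ := fun s => Λ ^ (n - 1) * X (n - 1) s ^ 2 - Λ ^ n * X n s * X (n + 1) s with hZdef
  have hZeq : ∀ t ∈ Icc a b, deriv (X n) t = Z t := fun t ht => deriv_eq_drive hlaw n (hsub t ht)
  set Z' : ℝ → ℝ := fun t => 2 * Λ ^ (n - 1) * X (n - 1) t * deriv (X (n - 1)) t
      - Λ ^ n * (deriv (X n) t * X (n + 1) t + X n t * deriv (X (n + 1)) t) with hZ'def
  have hZ : ∀ t ∈ Icc a b, HasDerivAt Z (Z' t) t := fun t ht => hasDerivAt_deriv hlaw n (hsub t ht)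
  have hcrit : ∀ t ∈ Ico a b, Z t = 0 → Z' t < 0 := by
    intro t ht h0
    have ht' : t ∈ Icc a b := ⟨ht.1, ht.2.le⟩
    have hd0 : deriv (X n) t = 0 := by rw [hZeq t ht', h0]
    have := drive_deriv_neg_of_lock hΛ (n := n) (w := X (n + 1) t) (hbelow₀ t ht') (hbelow t ht')
      (hmid t ht') (habove t ht')
    show 2 * Λ ^ (n - 1) * X (n - 1) t * deriv (X (n - 1)) t
      - Λ ^ n * (deriv (X n) t * X (n + 1) t + X n t * deriv (X (n + 1)) t) < 0
    rw [hd0]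
    exact this
  have ha' : a ∈ Icc a b := ⟨le_rfl, hab⟩
  have hZa : Z a ≤ 0 := by rw [← hZeq a ha']; exact hstart
  intro t ht
  rw [hZeq t ht]
  exact le_zero_of_deriv_neg_at_zeros hZ hcrit hZa t ht

/-- **EDGE LOCK (dual).**  On a window `[a,b] ⊂ (lo,hi)` on which shell `n−1` is positive and RISING (`Ẋₙ₋₁ > 0`), shell `n`
is non-negative and shell `n+1` is DECAYING (`Ẋₙ₊₁ ≤ 0`): if shell `n` is not decaying at time `a` (`Ẋₙ(a) ≥ 0`), it never
decays on `[a,b]`.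
[cite: Tao2016AveragedNS, §1.2 (dyadic model); cell vocabulary (door D4′ of stmt-21808)] -/
theorem shell_edge_lock (hΛ : 0 < Λ)
    (hlaw : ∀ (n : ℤ) (t : ℝ), t ∈ Ioo lo hi →
      HasDerivAt (X n) (Λ ^ (n - 1) * X (n - 1) t ^ 2 - Λ ^ n * X n t * X (n + 1) t) t)
    (n : ℤ) {a b : ℝ} (hab : a ≤ b) (hlo : lo < a) (hhi : b < hi)
    (hbelow₀ : ∀ t ∈ Icc a b, 0 < X (n - 1) t) (hbelow : ∀ t ∈ Icc a b, 0 < deriv (X (n - 1)) t)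
    (hmid : ∀ t ∈ Icc a b, 0 ≤ X n t) (habove : ∀ t ∈ Icc a b, deriv (X (n + 1)) t ≤ 0)
    (hstart : 0 ≤ deriv (X n) a) :
    ∀ t ∈ Icc a b, 0 ≤ deriv (X n) t := by
  have hsub : ∀ t ∈ Icc a b, t ∈ Ioo lo hi := fun t ht => ⟨hlo.trans_le ht.1, ht.2.trans_lt hhi⟩
  set Z : ℝ → ℝ := fun s => Λ ^ (n - 1) * X (n - 1) s ^ 2 - Λ ^ n * X n s * X (n + 1) s with hZdef
  have hZeq : ∀ t ∈ Icc a b, deriv (X n) t = Z t := fun t ht => deriv_eq_drive hlaw n (hsub t ht)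
  set Z' : ℝ → ℝ := fun t => 2 * Λ ^ (n - 1) * X (n - 1) t * deriv (X (n - 1)) t
      - Λ ^ n * (deriv (X n) t * X (n + 1) t + X n t * deriv (X (n + 1)) t) with hZ'def
  have hZ : ∀ t ∈ Icc a b, HasDerivAt Z (Z' t) t := fun t ht => hasDerivAt_deriv hlaw n (hsub t ht)
  have hcrit : ∀ t ∈ Ico a b, Z t = 0 → 0 < Z' t := by
    intro t ht h0
    have ht' : t ∈ Icc a b := ⟨ht.1, ht.2.le⟩
    have hd0 : deriv (X n) t = 0 := by rw [hZeq t ht', h0]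
    have := drive_deriv_pos_of_edge hΛ (n := n) (w := X (n + 1) t) (hbelow₀ t ht') (hbelow t ht')
      (hmid t ht') (habove t ht')
    show 0 < 2 * Λ ^ (n - 1) * X (n - 1) t * deriv (X (n - 1)) t
      - Λ ^ n * (deriv (X n) t * X (n + 1) t + X n t * deriv (X (n + 1)) t)
    rw [hd0]
    exact this
  have ha' : a ∈ Icc a b := ⟨le_rfl, hab⟩
  have hZa : 0 ≤ Z a := by rw [← hZeq a ha']; exact hstart
  intro t ht
  rw [hZeq t ht]
  exact nonneg_of_deriv_pos_at_zeros hZ hcrit hZa t ht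

/-- **Corollary (one-sided unimodality test).**  If on `[a,b]` shell `n−1 ≥ 0` decays, shell `n > 0`, shell `n+1` rises,
and `Ẋₙ(a) ≤ 0`, then `Xₙ` is non-increasing on `[a,b]`: no second hump of shell `n` can start inside such a window.
[cite: Tao2016AveragedNS, §1.2 (dyadic model); cell vocabulary (door D4′ of stmt-21808)] -/
theorem shell_antitoneOn_of_wake_lock (hΛ : 0 < Λ)
    (hlaw : ∀ (n : ℤ) (t : ℝ), t ∈ Ioo lo hi →
      HasDerivAt (X n) (Λ ^ (n - 1) * X (n - 1) t ^ 2 - Λ ^ n * X n t * X (n + 1) t) t)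
    (n : ℤ) {a b : ℝ} (hab : a ≤ b) (hlo : lo < a) (hhi : b < hi)
    (hbelow₀ : ∀ t ∈ Icc a b, 0 ≤ X (n - 1) t) (hbelow : ∀ t ∈ Icc a b, deriv (X (n - 1)) t ≤ 0)
    (hmid : ∀ t ∈ Icc a b, 0 < X n t) (habove : ∀ t ∈ Icc a b, 0 < deriv (X (n + 1)) t)
    (hstart : deriv (X n) a ≤ 0) :
    AntitoneOn (X n) (Icc a b) := by
  have hsub : ∀ t ∈ Icc a b, t ∈ Ioo lo hi := fun t ht => ⟨hlo.trans_le ht.1, ht.2.trans_lt hhi⟩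
  have hle := shell_wake_lock hΛ hlaw n hab hlo hhi hbelow₀ hbelow hmid habove hstart
  have hdiff : ∀ t ∈ Icc a b, DifferentiableAt ℝ (X n) t := fun t ht => (hlaw n t (hsub t ht)).differentiableAt
  refine antitoneOn_of_deriv_nonpos (convex_Icc a b)
    (fun t ht => (hdiff t ht).continuousAt.continuousWithinAt)
    (fun t ht => (hdiff t (interior_subset ht)).differentiableWithinAt) ?_
  intro t ht
  exact hle t (interior_subset ht)

end WakeRatchetDyadicWakeLock

end Summit.NavierStokesRegularity.NavierStokesRegularity.Theorems

end
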